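import Literature.Analysis.Calculus.HadamardLemma
import Literature.Analysis.FluidPDE.WholeSpaceIBP
import HarnessLib

/-!
# The Hadamard quotient by a coordinate: `w = x₀ · (w / x₀)` smoothly across `{x₀ = 0}`

Analysis/FluidPDE support file on the decomposition path of the named fact
`Literature.Analysis.FluidPDE.KNSS2009_liouville_axisymmetric_no_swirl` (Koch–Nadirashvili–
Seregin–Šverák, Acta Math. 203 (2009) = arXiv:0709.3599, Theorem 5.2). In the proof of
Theorem 5.2 (arXiv p. 10 with Remark 5.1, p. 9) the scalar `ω_θ / r` of an axisymmetric
swirl-free flow is used as a smooth function "even across the `x₃`-axis, as long as `u` is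
smooth" (Remark 5.1). For such flows `ω = ω_θ e_θ`, i.e. `ω₁ = x₀ f`, `ω₀ = −x₁ f` with
`f = ω_θ / r`, and `ω₁` vanishes on the plane `{x₀ = 0}`; the smooth quotient `f = ω₁ / x₀` is
Hadamard's `f(x) = ∫₀¹ ∂₀ω₁(s x₀, x₁, x₂) ds`. This file provides that quotient on
`ℝ³ = EuclideanSpace ℝ (Fin 3)` for functions with values in a complete normed space:

* `Literature.Analysis.FluidPDE.scaleFst s x = (s x₀, x₁, x₂)` (scaling of the first coordinate,
  linear in `x`, `Literature.Analysis.FluidPDE.scaleFstL s`, polynomial in `(s, x)`);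
* `Literature.Analysis.FluidPDE.hadamardQuotFst w x = ∫₀¹ ∂₀w(scaleFst s x) ds`;
* `smul_hadamardQuotFst`: if `w ∈ C¹` vanishes on `{x₀ = 0}` then `x₀ • hadamardQuotFst w x = w x`
  (Hadamard's lemma, first order, in one coordinate: fundamental theorem of calculus along
  `s ↦ w(scaleFst s x)`);
* `contDiff_hadamardQuotFst`: `w ∈ Cⁿ⁺¹ ⇒ hadamardQuotFst w ∈ Cⁿ` (smooth dependence of
  parametric integrals, `Literature.Analysis.Calculus.contDiff_intervalIntegral`);
* sup bounds: `‖hadamardQuotFst w‖ ≤ sup ‖∂₀w‖`, `‖D(hadamardQuotFst w)‖ ≤ sup ‖D∂₀w‖`,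
  `‖∂ₕ∂ₖ(hadamardQuotFst w)‖ ≤ sup ‖D²∂₀w‖ ‖h‖ ‖k‖`, `|Δ(hadamardQuotFst w)| ≤ 3 sup ‖D²∂₀w‖`
  (differentiation under the integral sign, `‖scaleFstL s‖ ≤ 1` for `s ∈ [0, 1]`), and the
  corresponding integral formulas for the first and second directional derivatives;
* joint continuity in a parameter of the quotient and of its first and second directional
  derivatives (for time-dependent vorticities).

All statements are folklore calculus (Hadamard's lemma: e.g. Milnor, *Morse theory*, Lemma 2.1).

## References

* G. Koch, N. Nadirashvili, G. Seregin, V. Šverák, *Liouville theorems for the Navier–Stokes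
  equations and applications*, Acta Math. 203 (2009) = arXiv:0709.3599, Remark 5.1 (p. 9) and
  the proof of Theorem 5.2 (p. 10). [KochNadirashviliSereginSverak2009]
* J. Milnor, *Morse theory*, Annals of Mathematics Studies 51 (1963), Lemma 2.1 (Hadamard's
  lemma). [folklore]
-/

noncomputable section

open MeasureTheory Set Function Filter Topology intervalIntegral
open scoped RealInnerProductSpace Laplacian ContDiff

namespace Literature.Analysis.FluidPDE

/-! ### Scaling the first coordinate -/

section Scale

/-- `scaleFst s x = (s x₀, x₁, x₂)`: scaling of the first coordinate of `x ∈ ℝ³`, written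
without case analysis as `x − ((1 − s) x₀) e₀`. [folklore] -/
def scaleFst (s : ℝ) (x : EuclideanSpace ℝ (Fin 3)) : EuclideanSpace ℝ (Fin 3) :=
  x - ((1 - s) * x 0) • EuclideanSpace.single 0 1

/-- First coordinate: `(scaleFst s x)₀ = s x₀`. [folklore] -/
@[simp] theorem scaleFst_apply_zero (s : ℝ) (x : EuclideanSpace ℝ (Fin 3)) :
    scaleFst s x 0 = s * x 0 := by
  simp [scaleFst]; ring

/-- Second coordinate unchanged: `(scaleFst s x)₁ = x₁`. [folklore] -/
@[simp] theorem scaleFst_apply_one (s : ℝ) (x : EuclideanSpace ℝ (Fin 3)) :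
    scaleFst s x 1 = x 1 := by
  simp [scaleFst]

/-- Third coordinate unchanged: `(scaleFst s x)₂ = x₂`. [folklore] -/
@[simp] theorem scaleFst_apply_two (s : ℝ) (x : EuclideanSpace ℝ (Fin 3)) :
    scaleFst s x 2 = x 2 := by
  simp [scaleFst]

/-- `scaleFst 1 = id`. [folklore] -/
@[simp] theorem scaleFst_one (x : EuclideanSpace ℝ (Fin 3)) : scaleFst 1 x = x := by
  simp [scaleFst]

/-- `scaleFst 0 x` lies on the plane `{x₀ = 0}`. [folklore] -/
theorem scaleFst_zero_apply_zero (x : EuclideanSpace ℝ (Fin 3)) : scaleFst 0 x 0 = 0 := by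
  simp

/-- The scaling as a continuous linear map of `ℝ³`. [folklore] -/
def scaleFstL (s : ℝ) : EuclideanSpace ℝ (Fin 3) →L[ℝ] EuclideanSpace ℝ (Fin 3) :=
  ContinuousLinearMap.id ℝ _ -
    ((1 - s) • ((ContinuousLinearMap.lsmul ℝ ℝ).flip (EuclideanSpace.single (0 : Fin 3) (1 : ℝ))).comp
      (EuclideanSpace.proj 0))

/-- `scaleFstL s` is `scaleFst s`. [folklore] -/
@[simp] theorem scaleFstL_apply (s : ℝ) (x : EuclideanSpace ℝ (Fin 3)) :
    scaleFstL s x = scaleFst s x := by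
  simp [scaleFstL, scaleFst, mul_smul]

/-- The scaling is a contraction for `s ∈ [0, 1]`: `‖scaleFst s x‖ ≤ ‖x‖`. [folklore] -/
theorem norm_scaleFst_le {s : ℝ} (hs : s ∈ Icc (0 : ℝ) 1) (x : EuclideanSpace ℝ (Fin 3)) :
    ‖scaleFst s x‖ ≤ ‖x‖ := by
  rw [EuclideanSpace.norm_eq, EuclideanSpace.norm_eq]
  refine Real.sqrt_le_sqrt ?_
  simp only [Fin.sum_univ_three, Real.norm_eq_abs, sq_abs, scaleFst_apply_zero, scaleFst_apply_one,
    scaleFst_apply_two]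
  have h1 : (s * x 0) ^ 2 ≤ x 0 ^ 2 := by
    rw [mul_pow]
    have : s ^ 2 ≤ 1 := by nlinarith [hs.1, hs.2]
    nlinarith [sq_nonneg (x 0)]
  linarith

/-- Operator norm: `‖scaleFstL s‖ ≤ 1` for `s ∈ [0, 1]`. [folklore] -/
theorem norm_scaleFstL_le {s : ℝ} (hs : s ∈ Icc (0 : ℝ) 1) : ‖scaleFstL s‖ ≤ 1 :=
  ContinuousLinearMap.opNorm_le_bound _ zero_le_one fun x => by
    rw [one_mul, scaleFstL_apply]; exact norm_scaleFst_le hs x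

/-- The scaling is jointly smooth (polynomial) in `(x, s)`. [folklore] -/
theorem contDiff_scaleFst_uncurry {n : WithTop ℕ∞} :
    ContDiff ℝ n fun p : EuclideanSpace ℝ (Fin 3) × ℝ => scaleFst p.2 p.1 := by
  unfold scaleFst
  have h0 : ContDiff ℝ n fun p : EuclideanSpace ℝ (Fin 3) × ℝ => p.1 0 :=
    (contDiff_piLp_apply (p := 2) (n := n) (i := (0 : Fin 3))).comp contDiff_fst
  exact contDiff_fst.sub (((contDiff_const.sub contDiff_snd).mul h0).smul contDiff_const)

/-- Derivative in `s`: `d/ds scaleFst s x = x₀ e₀`. [folklore] -/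
theorem hasDerivAt_scaleFst (x : EuclideanSpace ℝ (Fin 3)) (s : ℝ) :
    HasDerivAt (fun s => scaleFst s x) ((x 0) • EuclideanSpace.single 0 1) s := by
  unfold scaleFst
  have h1 : HasDerivAt (fun s : ℝ => (1 - s) * x 0) (-(x 0)) s := by
    simpa using ((hasDerivAt_id s).const_sub 1).mul_const (x 0)
  have h2 := (h1.smul_const (EuclideanSpace.single (0 : Fin 3) (1 : ℝ))).const_sub x
  simpa using h2

/-- Derivative in `x`: `D(scaleFst s)(x) = scaleFstL s`. [folklore] -/
theorem hasFDerivAt_scaleFst (s : ℝ) (x : EuclideanSpace ℝ (Fin 3)) :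
    HasFDerivAt (scaleFst s) (scaleFstL s) x := by
  have h : scaleFst s = fun x => scaleFstL s x := funext fun x => (scaleFstL_apply s x).symm
  rw [h]
  exact (scaleFstL s).hasFDerivAt

end Scale

/-! ### The Hadamard quotient -/

section Quotient

variable {F : Type*} [NormedAddCommGroup F] [NormedSpace ℝ F]

/-- **The Hadamard quotient of `w` by the first coordinate**:
`hadamardQuotFst w x = ∫₀¹ ∂₀w(s x₀, x₁, x₂) ds`, where `∂₀w = Dw(·) e₀`. For `w ∈ C¹` vanishing on
`{x₀ = 0}` this is the (unique continuous) quotient `w / x₀` (`smul_hadamardQuotFst`); Hadamard's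
lemma, first order, with respect to one coordinate (Milnor, *Morse theory*, Lemma 2.1). [folklore] -/
def hadamardQuotFst (w : EuclideanSpace ℝ (Fin 3) → F) (x : EuclideanSpace ℝ (Fin 3)) : F :=
  ∫ s in (0 : ℝ)..1, fderiv ℝ w (scaleFst s x) (EuclideanSpace.single 0 1)

/-- The integrand of the Hadamard quotient, as a function of `(x, s)`, is `Cⁿ` for `w ∈ Cⁿ⁺¹`. [folklore] -/
theorem contDiff_hadamardQuotFst_integrand {w : EuclideanSpace ℝ (Fin 3) → F} {n : ℕ∞}
    (hw : ContDiff ℝ (n + 1) w) :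
    ContDiff ℝ n (uncurry fun (x : EuclideanSpace ℝ (Fin 3)) (s : ℝ) =>
      fderiv ℝ w (scaleFst s x) (EuclideanSpace.single 0 1)) := by
  have h1 : ContDiff ℝ n fun y => fderiv ℝ w y (EuclideanSpace.single 0 1) :=
    (hw.fderiv_right (m := n) le_rfl).clm_apply contDiff_const
  exact h1.comp contDiff_scaleFst_uncurry

/-- **Hadamard's lemma (first order, one coordinate).** If `w ∈ C¹` vanishes on the plane
`{x₀ = 0}`, then `x₀ • hadamardQuotFst w x = w x` for every `x` (fundamental theorem of calculus
along `s ↦ w(s x₀, x₁, x₂)`, whose derivative is `x₀ ∂₀w(s x₀, x₁, x₂)`). [folklore] -/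
theorem smul_hadamardQuotFst [CompleteSpace F] {w : EuclideanSpace ℝ (Fin 3) → F} (hw : ContDiff ℝ 1 w)
    (h0 : ∀ x : EuclideanSpace ℝ (Fin 3), x 0 = 0 → w x = 0) (x : EuclideanSpace ℝ (Fin 3)) :
    (x 0) • hadamardQuotFst w x = w x := by
  -- derivative of `s ↦ w (scaleFst s x)`
  have hd : ∀ s, HasDerivAt (fun s => w (scaleFst s x))
      ((x 0) • fderiv ℝ w (scaleFst s x) (EuclideanSpace.single 0 1)) s := by
    intro s
    have h := ((hw.differentiable one_ne_zero) (scaleFst s x)).hasFDerivAt.comp_hasDerivAt s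
      (hasDerivAt_scaleFst x s)
    rw [ContinuousLinearMap.map_smul] at h
    exact h
  have hcont : Continuous fun s => (x 0) • fderiv ℝ w (scaleFst s x) (EuclideanSpace.single 0 1) :=
    continuous_const.smul (((contDiff_hadamardQuotFst_integrand (n := 0)
      (by exact_mod_cast hw)).continuous).comp (continuous_const.prodMk continuous_id))
  have hftc := integral_eq_sub_of_hasDerivAt (fun s _ => hd s) (hcont.intervalIntegrable 0 1)
  rw [intervalIntegral.integral_smul, scaleFst_one] at hftc
  rw [hadamardQuotFst, hftc, h0 _ (scaleFst_zero_apply_zero x), sub_zero]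

/-- **Smoothness of the Hadamard quotient**: `w ∈ Cⁿ⁺¹ ⇒ hadamardQuotFst w ∈ Cⁿ` (smooth
dependence of parametric integrals; KNSS 2009, Remark 5.1: `ω_θ/r` is smooth across the axis as
long as `u` is smooth). [folklore] -/
theorem contDiff_hadamardQuotFst [CompleteSpace F] {w : EuclideanSpace ℝ (Fin 3) → F} {n : ℕ∞}
    (hw : ContDiff ℝ (n + 1) w) : ContDiff ℝ n (hadamardQuotFst w) :=
  Calculus.contDiff_intervalIntegral (contDiff_hadamardQuotFst_integrand hw) 0 1

/-- **Sup bound**: `‖hadamardQuotFst w x‖ ≤ B` if `‖Dw‖ ≤ B` everywhere (no regularity needed: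
a non-integrable integrand has integral `0`). [folklore] -/
theorem norm_hadamardQuotFst_le {w : EuclideanSpace ℝ (Fin 3) → F} {B : ℝ}
    (hB : ∀ y, ‖fderiv ℝ w y‖ ≤ B) (x : EuclideanSpace ℝ (Fin 3)) : ‖hadamardQuotFst w x‖ ≤ B := by
  unfold hadamardQuotFst
  have h := intervalIntegral.norm_integral_le_of_norm_le_const (a := (0 : ℝ)) (b := 1) (C := B)
    (f := fun s => fderiv ℝ w (scaleFst s x) (EuclideanSpace.single 0 1)) fun s _ => ?_
  · simpa using h
  · calc ‖fderiv ℝ w (scaleFst s x) (EuclideanSpace.single 0 1)‖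
        ≤ ‖fderiv ℝ w (scaleFst s x)‖ * ‖(EuclideanSpace.single (0 : Fin 3) (1 : ℝ))‖ :=
          ContinuousLinearMap.le_opNorm _ _
      _ ≤ B * 1 := by
          refine mul_le_mul (hB _) ?_ (norm_nonneg _) ((norm_nonneg _).trans (hB 0))
          rw [PiLp.norm_single, norm_one]
      _ = B := mul_one B

/-! #### First derivative -/

/-- **Differentiation under the integral sign for the Hadamard quotient**: for `w ∈ C²`,
`D(hadamardQuotFst w)(x) = ∫₀¹ D(∂₀w)(scaleFst s x) ∘ scaleFstL s ds`. [folklore] -/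
theorem hasFDerivAt_hadamardQuotFst {w : EuclideanSpace ℝ (Fin 3) → F} (hw : ContDiff ℝ 2 w)
    (x : EuclideanSpace ℝ (Fin 3)) :
    HasFDerivAt (hadamardQuotFst w)
      (∫ s in (0 : ℝ)..1, (fderiv ℝ (fun y => fderiv ℝ w y (EuclideanSpace.single 0 1))
        (scaleFst s x)).comp (scaleFstL s)) x := by
  have hint : ContDiff ℝ 1 (uncurry fun (x : EuclideanSpace ℝ (Fin 3)) (s : ℝ) =>
      fderiv ℝ w (scaleFst s x) (EuclideanSpace.single 0 1)) :=
    contDiff_hadamardQuotFst_integrand (n := 1) (by exact_mod_cast hw)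
  have h := Calculus.hasFDerivAt_intervalIntegral_partialFDerivFst hint one_ne_zero 0 1 x
  -- identify the partial derivative of the integrand
  have hpart : ∀ s, Calculus.partialFDerivFst (fun (x : EuclideanSpace ℝ (Fin 3)) (s : ℝ) =>
      fderiv ℝ w (scaleFst s x) (EuclideanSpace.single 0 1)) x s =
      (fderiv ℝ (fun y => fderiv ℝ w y (EuclideanSpace.single 0 1)) (scaleFst s x)).comp
        (scaleFstL s) := by
    intro s
    rw [← Calculus.fderiv_eq_partialFDerivFst hint one_ne_zero x s]
    have hg : DifferentiableAt ℝ (fun y => fderiv ℝ w y (EuclideanSpace.single 0 1)) (scaleFst s x) :=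
      (((hw.fderiv_right (m := 1) (by norm_num)).clm_apply contDiff_const).differentiable
        one_ne_zero) _
    exact (hg.hasFDerivAt.comp x (hasFDerivAt_scaleFst s x)).fderiv
  have heq : (∫ s in (0 : ℝ)..1, Calculus.partialFDerivFst (fun (x : EuclideanSpace ℝ (Fin 3))
      (s : ℝ) => fderiv ℝ w (scaleFst s x) (EuclideanSpace.single 0 1)) x s) =
      ∫ s in (0 : ℝ)..1, (fderiv ℝ (fun y => fderiv ℝ w y (EuclideanSpace.single 0 1))
        (scaleFst s x)).comp (scaleFstL s) :=
    intervalIntegral.integral_congr fun s _ => hpart s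
  rw [heq] at h
  exact h

/-- **Sup bound for the derivative of the Hadamard quotient**: `‖D(hadamardQuotFst w)(x)‖ ≤ B` if
`‖D(∂₀w)‖ ≤ B` everywhere (`w ∈ C²`; `‖scaleFstL s‖ ≤ 1`). [folklore] -/
theorem norm_fderiv_hadamardQuotFst_le {w : EuclideanSpace ℝ (Fin 3) → F} (hw : ContDiff ℝ 2 w)
    {B : ℝ} (hB : ∀ y, ‖fderiv ℝ (fun y => fderiv ℝ w y (EuclideanSpace.single 0 1)) y‖ ≤ B)
    (x : EuclideanSpace ℝ (Fin 3)) : ‖fderiv ℝ (hadamardQuotFst w) x‖ ≤ B := by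
  rw [(hasFDerivAt_hadamardQuotFst hw x).fderiv]
  have hB0 : 0 ≤ B := (norm_nonneg _).trans (hB 0)
  have h := intervalIntegral.norm_integral_le_of_norm_le_const (a := (0 : ℝ)) (b := 1) (C := B)
    (f := fun s => (fderiv ℝ (fun y => fderiv ℝ w y (EuclideanSpace.single 0 1))
      (scaleFst s x)).comp (scaleFstL s)) fun s hs => ?_
  · simpa using h
  · rw [uIoc_of_le zero_le_one] at hs
    calc ‖(fderiv ℝ (fun y => fderiv ℝ w y (EuclideanSpace.single 0 1)) (scaleFst s x)).comp
          (scaleFstL s)‖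
        ≤ ‖fderiv ℝ (fun y => fderiv ℝ w y (EuclideanSpace.single 0 1)) (scaleFst s x)‖ *
            ‖scaleFstL s‖ := ContinuousLinearMap.opNorm_comp_le _ _
      _ ≤ B * 1 := mul_le_mul (hB _) (norm_scaleFstL_le ⟨hs.1.le, hs.2⟩) (norm_nonneg _) hB0
      _ = B := mul_one B

/-- **The directional derivative of the Hadamard quotient as a parametric integral**: for `w ∈ C²`,
`∂ₕ(hadamardQuotFst w)(x) = ∫₀¹ D(∂₀w)(scaleFst s x)(scaleFst s h) ds`. [folklore] -/
theorem fderiv_hadamardQuotFst_apply {w : EuclideanSpace ℝ (Fin 3) → F} (hw : ContDiff ℝ 2 w)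
    (x h : EuclideanSpace ℝ (Fin 3)) :
    fderiv ℝ (hadamardQuotFst w) x h =
      ∫ s in (0 : ℝ)..1, fderiv ℝ (fun y => fderiv ℝ w y (EuclideanSpace.single 0 1))
        (scaleFst s x) (scaleFst s h) := by
  rw [(hasFDerivAt_hadamardQuotFst hw x).fderiv]
  have hc : Continuous fun s : ℝ => (fderiv ℝ (fun y => fderiv ℝ w y (EuclideanSpace.single 0 1))
      (scaleFst s x)).comp (scaleFstL s) := by
    have h1 : Continuous fun s : ℝ => fderiv ℝ (fun y => fderiv ℝ w y (EuclideanSpace.single 0 1))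
        (scaleFst s x) :=
      ((((hw.fderiv_right (m := 1) (by norm_num)).clm_apply contDiff_const).continuous_fderiv
        one_ne_zero).comp (contDiff_scaleFst_uncurry (n := 0)).continuous).comp
        (continuous_const.prodMk continuous_id)
    have h2 : Continuous fun s : ℝ => scaleFstL s := by
      unfold scaleFstL
      fun_prop
    exact h1.clm_comp h2
  rw [ContinuousLinearMap.intervalIntegral_apply (hc.intervalIntegrable _ _) h]
  refine intervalIntegral.integral_congr fun s _ => ?_
  simp only [ContinuousLinearMap.comp_apply, scaleFstL_apply]

/-! #### Second directional derivatives and the Laplacian -/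

/-- **Second directional derivatives of the Hadamard quotient**: for `w ∈ C³`,
`∂ₖ∂ₕ(hadamardQuotFst w)(x) = ∫₀¹ D²(∂₀w)(scaleFst s x)(scaleFst s h, scaleFst s k) ds`, written
with iterated directional `fderiv`s. [folklore] -/
theorem fderiv_fderiv_hadamardQuotFst_apply [CompleteSpace F] {w : EuclideanSpace ℝ (Fin 3) → F}
    (hw : ContDiff ℝ 3 w)
    (x h k : EuclideanSpace ℝ (Fin 3)) :
    fderiv ℝ (fun x => fderiv ℝ (hadamardQuotFst w) x h) x k =
      ∫ s in (0 : ℝ)..1, fderiv ℝ (fun y => fderiv ℝ (fun y => fderiv ℝ w y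
        (EuclideanSpace.single 0 1)) y (scaleFst s h)) (scaleFst s x) (scaleFst s k) := by
  have hw2 : ContDiff ℝ 2 w := hw.of_le (by norm_num)
  -- the first directional derivative as a parametric integral with `C¹` integrand
  set G : EuclideanSpace ℝ (Fin 3) → ℝ → F := fun x s =>
    fderiv ℝ (fun y => fderiv ℝ w y (EuclideanSpace.single 0 1)) (scaleFst s x) (scaleFst s h)
    with hG
  have hD1 : (fun x => fderiv ℝ (hadamardQuotFst w) x h) = fun x => ∫ s in (0 : ℝ)..1, G x s :=
    funext fun x => fderiv_hadamardQuotFst_apply hw2 x h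
  rw [hD1]
  -- `G` is `C¹` in `(x, s)`
  have hφ : ContDiff ℝ 2 fun y => fderiv ℝ w y (EuclideanSpace.single 0 1) :=
    (hw.fderiv_right (m := 2) (by norm_num)).clm_apply contDiff_const
  have hGc : ContDiff ℝ 1 (uncurry G) := by
    have h1 : ContDiff ℝ 1 fun p : EuclideanSpace ℝ (Fin 3) × ℝ =>
        fderiv ℝ (fun y => fderiv ℝ w y (EuclideanSpace.single 0 1)) (scaleFst p.2 p.1) :=
      (hφ.fderiv_right (m := 1) (by norm_num)).comp contDiff_scaleFst_uncurry
    have h2 : ContDiff ℝ 1 fun p : EuclideanSpace ℝ (Fin 3) × ℝ => scaleFst p.2 h :=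
      contDiff_scaleFst_uncurry.comp (contDiff_const.prodMk contDiff_snd)
    exact h1.clm_apply h2
  rw [Calculus.fderiv_intervalIntegral_apply_eq_partialFDerivFst hGc one_ne_zero 0 1 x k]
  refine intervalIntegral.integral_congr fun s _ => ?_
  rw [← Calculus.fderiv_eq_partialFDerivFst hGc one_ne_zero x s]
  -- chain rule for `x ↦ G x s`
  have hg : DifferentiableAt ℝ (fun y => fderiv ℝ (fun y => fderiv ℝ w y
      (EuclideanSpace.single 0 1)) y (scaleFst s h)) (scaleFst s x) :=
    (((hφ.fderiv_right (m := 1) (by norm_num)).clm_apply contDiff_const).differentiable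
      one_ne_zero) _
  have hcomp := hg.hasFDerivAt.comp x (hasFDerivAt_scaleFst s x)
  rw [show (fun x => G x s) = (fun y => fderiv ℝ (fun y => fderiv ℝ w y
      (EuclideanSpace.single 0 1)) y (scaleFst s h)) ∘ scaleFst s from rfl, hcomp.fderiv]
  simp only [ContinuousLinearMap.comp_apply, scaleFstL_apply]

/-- **Sup bound for the second directional derivatives**: for `w ∈ C³` with
`‖D²(∂₀w)(y)‖ ≤ B` everywhere (as the operator norm of `D(y ↦ D(∂₀w)(y))`),
`‖∂ₖ∂ₕ(hadamardQuotFst w)(x)‖ ≤ B ‖h‖ ‖k‖`. [folklore] -/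
theorem norm_fderiv_fderiv_hadamardQuotFst_apply_le [CompleteSpace F] {w : EuclideanSpace ℝ (Fin 3) → F}
    (hw : ContDiff ℝ 3 w) {B : ℝ}
    (hB : ∀ y, ‖fderiv ℝ (fderiv ℝ (fun y => fderiv ℝ w y (EuclideanSpace.single 0 1))) y‖ ≤ B)
    (x h k : EuclideanSpace ℝ (Fin 3)) :
    ‖fderiv ℝ (fun x => fderiv ℝ (hadamardQuotFst w) x h) x k‖ ≤ B * ‖h‖ * ‖k‖ := by
  rw [fderiv_fderiv_hadamardQuotFst_apply hw x h k]
  have hB0 : 0 ≤ B :=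
    le_trans (norm_nonneg (fderiv ℝ (fderiv ℝ fun y => fderiv ℝ w y
      (EuclideanSpace.single 0 1)) 0)) (hB 0)
  have hφ : ContDiff ℝ 2 fun y => fderiv ℝ w y (EuclideanSpace.single 0 1) :=
    (hw.fderiv_right (m := 2) (by norm_num)).clm_apply contDiff_const
  have h' := intervalIntegral.norm_integral_le_of_norm_le_const (a := (0 : ℝ)) (b := 1)
    (C := B * ‖h‖ * ‖k‖)
    (f := fun s => fderiv ℝ (fun y => fderiv ℝ (fun y => fderiv ℝ w y
        (EuclideanSpace.single 0 1)) y (scaleFst s h)) (scaleFst s x) (scaleFst s k))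
    fun s hs => ?_
  · simpa using h'
  · rw [uIoc_of_le zero_le_one] at hs
    have hs' : s ∈ Icc (0 : ℝ) 1 := ⟨hs.1.le, hs.2⟩
    have hd : DifferentiableAt ℝ (fderiv ℝ fun y => fderiv ℝ w y (EuclideanSpace.single 0 1))
        (scaleFst s x) :=
      ((hφ.fderiv_right (m := 1) (by norm_num)).differentiable one_ne_zero) _
    rw [fderiv_clm_apply hd (differentiableAt_const _)]
    simp only [add_apply, ContinuousLinearMap.comp_apply,
      ContinuousLinearMap.flip_apply, fderiv_fun_const, Pi.zero_apply, zero_apply, map_zero, zero_add]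
    calc ‖fderiv ℝ (fderiv ℝ fun y => fderiv ℝ w y (EuclideanSpace.single 0 1)) (scaleFst s x)
          (scaleFst s k) (scaleFst s h)‖
        ≤ ‖fderiv ℝ (fderiv ℝ fun y => fderiv ℝ w y (EuclideanSpace.single 0 1)) (scaleFst s x)
            (scaleFst s k)‖ * ‖scaleFst s h‖ := ContinuousLinearMap.le_opNorm _ _
      _ ≤ (‖fderiv ℝ (fderiv ℝ fun y => fderiv ℝ w y (EuclideanSpace.single 0 1)) (scaleFst s x)‖
            * ‖scaleFst s k‖) * ‖scaleFst s h‖ :=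
          mul_le_mul_of_nonneg_right (ContinuousLinearMap.le_opNorm _ _) (norm_nonneg _)
      _ ≤ (B * ‖k‖) * ‖h‖ :=
          mul_le_mul (mul_le_mul (hB _) (norm_scaleFst_le hs' k) (norm_nonneg _) hB0)
            (norm_scaleFst_le hs' h) (norm_nonneg _) (by positivity)
      _ = B * ‖h‖ * ‖k‖ := by ring

/-- **Sup bound for the Laplacian of the Hadamard quotient** of a real function: for `w ∈ C³`
with `‖D²(∂₀w)‖ ≤ B` everywhere, `|Δ(hadamardQuotFst w)(x)| ≤ 3B` (`Δ = Σᵢ ∂ᵢ∂ᵢ` over the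
standard frame). [folklore] -/
theorem abs_laplacian_hadamardQuotFst_le {w : EuclideanSpace ℝ (Fin 3) → ℝ} (hw : ContDiff ℝ 3 w)
    {B : ℝ}
    (hB : ∀ y, ‖fderiv ℝ (fderiv ℝ (fun y => fderiv ℝ w y (EuclideanSpace.single 0 1))) y‖ ≤ B)
    (x : EuclideanSpace ℝ (Fin 3)) : |(Δ (hadamardQuotFst w)) x| ≤ 3 * B := by
  have hf2 : ContDiff ℝ 2 (hadamardQuotFst w) :=
    contDiff_hadamardQuotFst (n := 2) (by exact_mod_cast hw)
  set b := EuclideanSpace.basisFun (Fin 3) ℝ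
  rw [laplacian_eq_sum_fderiv_fderiv b hf2 x]
  calc |∑ i, fderiv ℝ (fun y => fderiv ℝ (hadamardQuotFst w) y (b i)) x (b i)|
      ≤ ∑ i, |fderiv ℝ (fun y => fderiv ℝ (hadamardQuotFst w) y (b i)) x (b i)| :=
        Finset.abs_sum_le_sum_abs _ _
    _ ≤ ∑ _i : Fin 3, B := Finset.sum_le_sum fun i _ => by
        have h := norm_fderiv_fderiv_hadamardQuotFst_apply_le hw hB x (b i) (b i)
        rw [b.orthonormal.1 i, mul_one, mul_one, Real.norm_eq_abs] at h
        exact h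
    _ = 3 * B := by simp

/-! #### Joint continuity in a parameter -/

variable {X : Type*} [TopologicalSpace X]

/-- **Continuity of the Hadamard quotient in a parameter**: if `(p, y) ↦ ∂₀(w p)(y)` is
continuous then `(p, x) ↦ hadamardQuotFst (w p) x` is continuous. [folklore] -/
theorem continuous_hadamardQuotFst_param {w : X → EuclideanSpace ℝ (Fin 3) → F}
    (hc : Continuous fun q : X × EuclideanSpace ℝ (Fin 3) =>
      fderiv ℝ (w q.1) q.2 (EuclideanSpace.single 0 1)) :
    Continuous fun q : X × EuclideanSpace ℝ (Fin 3) => hadamardQuotFst (w q.1) q.2 := by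
  unfold hadamardQuotFst
  refine intervalIntegral.continuous_parametric_intervalIntegral_of_continuous' ?_ 0 1
  have h1 : Continuous fun r : (X × EuclideanSpace ℝ (Fin 3)) × ℝ => (r.1.1, scaleFst r.2 r.1.2) :=
    continuous_fst.fst.prodMk ((contDiff_scaleFst_uncurry (n := 0)).continuous.comp
      (continuous_fst.snd.prodMk continuous_snd))
  exact hc.comp h1

/-- **Continuity of the first directional derivatives in a parameter**: if every `w p` is `C²`
and `(p, y) ↦ D(∂₀(w p))(y)` is continuous, then `(p, x) ↦ ∂ₕ(hadamardQuotFst (w p))(x)` is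
continuous for every direction `h`. [folklore] -/
theorem continuous_fderiv_hadamardQuotFst_apply_param {w : X → EuclideanSpace ℝ (Fin 3) → F}
    (hw : ∀ p, ContDiff ℝ 2 (w p))
    (hc : Continuous fun q : X × EuclideanSpace ℝ (Fin 3) =>
      fderiv ℝ (fun y => fderiv ℝ (w q.1) y (EuclideanSpace.single 0 1)) q.2)
    (h : EuclideanSpace ℝ (Fin 3)) :
    Continuous fun q : X × EuclideanSpace ℝ (Fin 3) =>
      fderiv ℝ (hadamardQuotFst (w q.1)) q.2 h := by
  have heq : (fun q : X × EuclideanSpace ℝ (Fin 3) => fderiv ℝ (hadamardQuotFst (w q.1)) q.2 h) =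
      fun q => ∫ s in (0 : ℝ)..1, fderiv ℝ (fun y => fderiv ℝ (w q.1) y
        (EuclideanSpace.single 0 1)) (scaleFst s q.2) (scaleFst s h) :=
    funext fun q => fderiv_hadamardQuotFst_apply (hw q.1) q.2 h
  rw [heq]
  refine intervalIntegral.continuous_parametric_intervalIntegral_of_continuous' ?_ 0 1
  have h1 : Continuous fun r : (X × EuclideanSpace ℝ (Fin 3)) × ℝ => (r.1.1, scaleFst r.2 r.1.2) :=
    continuous_fst.fst.prodMk ((contDiff_scaleFst_uncurry (n := 0)).continuous.comp
      (continuous_fst.snd.prodMk continuous_snd))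
  have h2 : Continuous fun r : (X × EuclideanSpace ℝ (Fin 3)) × ℝ => scaleFst r.2 h :=
    (contDiff_scaleFst_uncurry (n := 0)).continuous.comp (continuous_const.prodMk continuous_snd)
  exact (hc.comp h1).clm_apply h2

/-- **Continuity of the second directional derivatives in a parameter**: if every `w p` is `C³`
and `(p, y) ↦ D²(∂₀(w p))(y)` (the derivative of `y ↦ D(∂₀(w p))(y)`) is continuous, then
`(p, x) ↦ ∂ₖ∂ₕ(hadamardQuotFst (w p))(x)` is continuous for all directions `h, k`. [folklore] -/
theorem continuous_fderiv_fderiv_hadamardQuotFst_apply_param [CompleteSpace F]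
    {w : X → EuclideanSpace ℝ (Fin 3) → F}
    (hw : ∀ p, ContDiff ℝ 3 (w p))
    (hc : Continuous fun q : X × EuclideanSpace ℝ (Fin 3) =>
      fderiv ℝ (fderiv ℝ (fun y => fderiv ℝ (w q.1) y (EuclideanSpace.single 0 1))) q.2)
    (h k : EuclideanSpace ℝ (Fin 3)) :
    Continuous fun q : X × EuclideanSpace ℝ (Fin 3) =>
      fderiv ℝ (fun x => fderiv ℝ (hadamardQuotFst (w q.1)) x h) q.2 k := by
  have heq : (fun q : X × EuclideanSpace ℝ (Fin 3) =>
      fderiv ℝ (fun x => fderiv ℝ (hadamardQuotFst (w q.1)) x h) q.2 k) =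
      fun q => ∫ s in (0 : ℝ)..1, fderiv ℝ (fun y => fderiv ℝ (fun y => fderiv ℝ (w q.1) y
        (EuclideanSpace.single 0 1)) y (scaleFst s h)) (scaleFst s q.2) (scaleFst s k) :=
    funext fun q => fderiv_fderiv_hadamardQuotFst_apply (hw q.1) q.2 h k
  rw [heq]
  refine intervalIntegral.continuous_parametric_intervalIntegral_of_continuous' ?_ 0 1
  -- rewrite the integrand through `D(y ↦ D(∂₀ w)(y))` applied twice
  have hφ : ∀ p, ContDiff ℝ 2 fun y => fderiv ℝ (w p) y (EuclideanSpace.single 0 1) := fun p =>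
    ((hw p).fderiv_right (m := 2) (by norm_num)).clm_apply contDiff_const
  have hrw : ∀ (p : X) (s : ℝ) (x : EuclideanSpace ℝ (Fin 3)),
      fderiv ℝ (fun y => fderiv ℝ (fun y => fderiv ℝ (w p) y (EuclideanSpace.single 0 1)) y
        (scaleFst s h)) (scaleFst s x) (scaleFst s k) =
      fderiv ℝ (fderiv ℝ fun y => fderiv ℝ (w p) y (EuclideanSpace.single 0 1)) (scaleFst s x)
        (scaleFst s k) (scaleFst s h) := by
    intro p s x
    have hd : DifferentiableAt ℝ (fderiv ℝ fun y => fderiv ℝ (w p) y (EuclideanSpace.single 0 1))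
        (scaleFst s x) :=
      (((hφ p).fderiv_right (m := 1) (by norm_num)).differentiable one_ne_zero) _
    rw [fderiv_clm_apply hd (differentiableAt_const _)]
    simp only [add_apply, ContinuousLinearMap.comp_apply,
      ContinuousLinearMap.flip_apply, fderiv_fun_const, Pi.zero_apply, zero_apply, map_zero, zero_add]
  have heq2 : (uncurry fun (q : X × EuclideanSpace ℝ (Fin 3)) (s : ℝ) =>
      fderiv ℝ (fun y => fderiv ℝ (fun y => fderiv ℝ (w q.1) y (EuclideanSpace.single 0 1)) y
        (scaleFst s h)) (scaleFst s q.2) (scaleFst s k)) =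
      fun r : (X × EuclideanSpace ℝ (Fin 3)) × ℝ =>
        fderiv ℝ (fderiv ℝ fun y => fderiv ℝ (w r.1.1) y (EuclideanSpace.single 0 1))
          (scaleFst r.2 r.1.2) (scaleFst r.2 k) (scaleFst r.2 h) := by
    funext r
    exact hrw r.1.1 r.2 r.1.2
  rw [heq2]
  have h1 : Continuous fun r : (X × EuclideanSpace ℝ (Fin 3)) × ℝ => (r.1.1, scaleFst r.2 r.1.2) :=
    continuous_fst.fst.prodMk ((contDiff_scaleFst_uncurry (n := 0)).continuous.comp
      (continuous_fst.snd.prodMk continuous_snd))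
  have h2 : ∀ v : EuclideanSpace ℝ (Fin 3),
      Continuous fun r : (X × EuclideanSpace ℝ (Fin 3)) × ℝ => scaleFst r.2 v := fun v =>
    (contDiff_scaleFst_uncurry (n := 0)).continuous.comp (continuous_const.prodMk continuous_snd)
  exact ((hc.comp h1).clm_apply (h2 k)).clm_apply (h2 h)

end Quotient

end Literature.Analysis.FluidPDE

end
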